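import Mathlib
import Summits.Ventures.HodgeRepro.Tier4.Common.AdelicDefs
import Summits.Ventures.HodgeRepro.Tier4.Common.AdelicPlaces
import Summits.Ventures.HodgeRepro.Tier4.Common.LocalTorus
import Summits.Ventures.HodgeRepro.Tier4.Common.CompactOpenLevel
import Summits.Ventures.HodgeRepro.Tier4.Common.LevelBasis
import Summits.Ventures.HodgeRepro.Tier4.Line1.RTFSetting
import Summits.Ventures.HodgeRepro.Tier4.Line1.RationalPoints
import Summits.Ventures.HodgeRepro.Tier4.Line1.SecondCountableGA
import Summits.Ventures.HodgeRepro.Tier4.Line1.CompactAverage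
import Summits.Ventures.HodgeRepro.Tier4.Line1.LeftTypeOfMatrixCoeff
import Summits.Ventures.HodgeRepro.Tier4.Line1.ArchMatrixCoeff
import Summits.Ventures.HodgeRepro.Tier4.Line1.FinLevelCompact
import Summits.Ventures.HodgeRepro.Tier4.Line1.IsolatingTestsDeepLevel
import Summits.Ventures.HodgeRepro.Tier4.Line1.FiniteRankTypeApprox

/-!
# Tier4/Line1/ArchDensity — on `U(W)(𝔸_k)` with compact archimedean part, every test function is uniformly
approximable, off a fixed bi-invariant compact open set, by a test function of finite-rank left-`K_f(N) × G_∞`-type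

Blind re-derivation cell `pub-hodge-repro`, Tier 4 (README §9–§10), seat t4-L1-p4 (gen 4), LINE L1.  Target tree path
`lean/Summits/Ventures/HodgeRepro/Tier4/Line1/ArchDensity.lean`.  Imports this seat's FiniteRankTypeApprox (the generic
Stone–Weierstrass density `exists_finiteRankLeftType_approx`), p2's ArchMatrixCoeff (`archMat`, `finLevel`,
`finLevel_inf_finitePart`, `continuous_archMat_entry`, `hasFiniteRankLeftType_coeffFn`) and FinLevelCompact
(`isCompact_finLevel`), p3's CompactAverage (`avgL`), typer-2's LocalTorus (`finitePart`) / AdelicPlaces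
(`GA.infiniteComponent`) / LevelBasis (`exists_levelK_subset_nhds_one`).  0 print.

THE COORDINATES.  On a compact open `X ⊆ U(W)(𝔸_k)` that is left-`K_N`-invariant (`K_N = finLevel W N = K_f(N) × G_∞`,
compact open under `hC : IsCompact (archImage W)`), the coordinates are (i) the characteristic functions of the finitely
many right cosets `K_N · x` covering `X`, and (ii) the archimedean matrix entries `g ↦ archMat W w g i j` at every
infinite place `w`.  Each cut-off `1_X · u` has a finite-rank left-`K_N`-type (p2's `hasFiniteRankLeftType_coeffFn` for
the entries, rank `1` for the coset indicators).  THE FIBRE CONDITION (`mem_finitePart_of_archMat_eq_one`,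
`mem_levelK_of_archMat_eq`): two points of `X` in the same `K_N`-coset with the same archimedean entries differ by an
element of `K_N` with trivial archimedean component, i.e. of `K(N) = levelK W N` (`finLevel_inf_finitePart`; the
entries determine the archimedean component since Mathlib's `extensionEmbedding w : k_w →+* ℂ` is injective) — so a
left-`K(N)`-invariant function is constant on the fibres.

WHAT IS PROVED.  **`exists_finiteRankLeftType_approx_of_left_invariant`**: for a continuous left-`K(N)`-invariant `f₀`
vanishing off `X`, and `η > 0`, a test function `h` vanishing off `X`, of finite-rank left-`finLevel W N`-type, with
`‖h − f₀‖_∞ ≤ η`.  **`exists_finiteRankLeftType_approx_deep`**: for ANY test function `f₀` vanishing off `X` (`X`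
bi-invariant under some level `N₁`), a level `N ≠ 0` and such an `h` of finite-rank left-`finLevel W N`-type — first the
left average over a deep `K(N)` (uniformly `η/2`-close by uniform continuity, p3's `norm_avgL_sub_le`), then the
theorem above.  Nothing here says anything about the status of the Hodge conjecture for CM abelian varieties, which is
NOT proved (HC_CM is NOT proved by anyone in this repository).
-/

set_option autoImplicit false

noncomputable section

namespace Summit.Ventures.HodgeRepro.Tier4.Line1

open NumberField Common Topology
open scoped Pointwise

section Fibre

variable {k : Type} [Field k] [NumberField k] (W : PlaneData k)

/-- **the archimedean entries determine the archimedean component**: an element of `U(W)(𝔸_k)` whose archimedean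
standard representation is the identity at every infinite place lies in the finite part (`extensionEmbedding w` is
injective). -/
theorem mem_finitePart_of_archMat_eq_one {g : GA W}
    (h : ∀ (w : InfinitePlace k) (i j : Fin 4), archMat W w g i j = (1 : Matrix (Fin 4) (Fin 4) ℂ) i j) :
    g ∈ finitePart W := by
  rw [mem_finitePart]
  intro w
  apply Units.ext
  apply Matrix.ext
  intro i j
  have hinj : Function.Injective (InfinitePlace.Completion.extensionEmbedding w) :=
    (InfinitePlace.Completion.extensionEmbedding w).injective
  apply hinj
  have h1 : InfinitePlace.Completion.extensionEmbedding w
      (((GA.infiniteComponent W w g : GL (Fin 4) w.Completion) : Matrix (Fin 4) (Fin 4) w.Completion) i j) =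
      archMat W w g i j := rfl
  rw [h1, h w i j]
  simp only [Units.val_one, Matrix.one_apply]
  split_ifs <;> simp

/-- two points whose quotient lies in `K_f(N) × G_∞` and whose archimedean entries agree differ by an element of
`K(N)` (`finLevel_inf_finitePart`). -/
theorem mem_levelK_of_archMat_eq {N : ℕ} {x y : GA W} (hyx : y * x⁻¹ ∈ finLevel W N)
    (h : ∀ (w : InfinitePlace k) (i j : Fin 4), archMat W w x i j = archMat W w y i j) :
    y * x⁻¹ ∈ levelK W N := by
  rw [← finLevel_inf_finitePart, Subgroup.mem_inf]
  refine ⟨hyx, mem_finitePart_of_archMat_eq_one W ?_⟩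
  intro w i j
  have hmat : archMat W w y = archMat W w x := Matrix.ext fun i j => (h w i j).symm
  rw [map_mul, hmat, ← map_mul, mul_inv_cancel, map_one]

end Fibre

section Coset

variable {G : Type} [Group G] [TopologicalSpace G] [IsTopologicalGroup G] (K : Subgroup G)

omit [TopologicalSpace G] [IsTopologicalGroup G] in
/-- membership in the right coset `K · x`. -/
theorem mem_coset_iff (x g : G) : g ∈ (K : Set G) * {x} ↔ g * x⁻¹ ∈ K := by
  rw [Set.mul_singleton, Set.mem_image]
  constructor
  · rintro ⟨a, ha, rfl⟩
    simpa using ha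
  · intro h
    exact ⟨g * x⁻¹, h, by simp⟩

omit [TopologicalSpace G] [IsTopologicalGroup G] in
/-- the right coset `K · x` is left-`K`-invariant. -/
theorem coset_left_invariant {k₀ : G} (hk : k₀ ∈ K) (x g : G) :
    k₀ * g ∈ (K : Set G) * {x} ↔ g ∈ (K : Set G) * {x} := by
  rw [mem_coset_iff, mem_coset_iff, mul_assoc, K.mul_mem_cancel_left hk]

/-- the right coset `K · x` of a compact subgroup is compact. -/
theorem isCompact_coset (hKc : IsCompact (K : Set G)) (x : G) : IsCompact ((K : Set G) * {x}) :=
  hKc.mul isCompact_singleton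

/-- the right coset `K · x` of an open subgroup is open. -/
theorem isOpen_coset (hKo : IsOpen (K : Set G)) (x : G) : IsOpen ((K : Set G) * {x}) :=
  hKo.mul_right

end Coset

section Density

variable {k : Type} [Field k] [NumberField k] (W : PlaneData k)

/-- **the instance density for left-`K(N)`-invariant functions**: with `hC : IsCompact (archImage W)` and a compact
open left-`finLevel W N`-invariant `X`, every continuous left-`levelK W N`-invariant `f₀` vanishing off `X` is
uniformly `η`-approximable by a test function vanishing off `X` of finite-rank left-`finLevel W N`-type (the
coordinates: the coset indicators of a finite cover of `X` and the archimedean entries). -/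
theorem exists_finiteRankLeftType_approx_of_left_invariant (hC : IsCompact (archImage W)) {N : ℕ} (hN : N ≠ 0)
    {X : Set (GA W)} (hXc : IsCompact X) (hXo : IsOpen X) (hKX : ∀ k ∈ finLevel W N, ∀ g, k * g ∈ X ↔ g ∈ X)
    {f₀ : GA W → ℂ} (h₀ : Continuous f₀) (hf₀ : ∀ g, g ∉ X → f₀ g = 0)
    (hinv : ∀ k ∈ levelK W N, ∀ g, f₀ (k * g) = f₀ g) {η : ℝ} (hη : 0 < η) :
    ∃ h : GA W → ℂ, RTF.IsTest h ∧ (∀ g, g ∉ X → h g = 0) ∧ RTF.HasFiniteRankLeftType (finLevel W N) h ∧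
      ∀ g, ‖h g - f₀ g‖ ≤ η := by
  classical
  haveI : T2Space (GA W) := t2Space_GA W
  have hKc : IsCompact (finLevel W N : Set (GA W)) := isCompact_finLevel W hC hN
  have hKo : IsOpen (finLevel W N : Set (GA W)) := isOpen_finLevel W hN
  -- a finite cover of `X` by right cosets of `K_N`
  obtain ⟨t, htX, hcover⟩ := hXc.elim_nhds_subcover (fun x => (finLevel W N : Set (GA W)) * {x})
    (fun x _ => (isOpen_coset (finLevel W N) hKo x).mem_nhds
      ((mem_coset_iff (finLevel W N) x x).2 (by rw [mul_inv_cancel]; exact (finLevel W N).one_mem)))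
  -- the coordinates
  let u : ({x // x ∈ t} ⊕ (InfinitePlace k × Fin 4 × Fin 4)) → GA W → ℂ :=
    Sum.elim (fun x => ((finLevel W N : Set (GA W)) * {(x : GA W)}).indicator fun _ => (1 : ℂ))
      (fun p => fun g => archMat W p.1 g p.2.1 p.2.2)
  have hu : ∀ i, Continuous (u i) := by
    rintro (x | ⟨w, i, j⟩)
    · exact (RTF.isTest_indicator_of_isCompact_isOpen (isCompact_coset (finLevel W N) hKc x)
        (isOpen_coset (finLevel W N) hKo x) 1).cont
    · exact continuous_archMat_entry W w i j
  have hX1 : RTF.HasFiniteRankLeftType (finLevel W N) (X.indicator fun _ => (1 : ℂ)) :=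
    RTF.hasFiniteRankLeftType_indicator_of_left_invariant hXc hXo hKX 1
  have hX1t : RTF.IsTest (X.indicator fun _ => (1 : ℂ)) := RTF.isTest_indicator_of_isCompact_isOpen hXc hXo 1
  have hX1inv : ∀ k ∈ finLevel W N, ∀ g, X.indicator (fun _ => (1 : ℂ)) (k * g) =
      X.indicator (fun _ => (1 : ℂ)) g := by
    intro k hk g
    by_cases hg : g ∈ X
    · rw [Set.indicator_of_mem ((hKX k hk g).2 hg), Set.indicator_of_mem hg]
    · rw [Set.indicator_of_notMem (fun h => hg ((hKX k hk g).1 h)), Set.indicator_of_notMem hg]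
  have hut : ∀ i, RTF.HasFiniteRankLeftType (finLevel W N) (X.indicator (u i)) := by
    rintro (x | ⟨w, i, j⟩)
    · have hsub : (finLevel W N : Set (GA W)) * {(x : GA W)} ⊆ X := by
        intro g hg
        obtain ⟨a, ha, b, hb, rfl⟩ := Set.mem_mul.1 hg
        rw [Set.mem_singleton_iff] at hb
        subst hb
        exact (hKX a ha _).2 (htX x x.2)
      have : X.indicator (u (Sum.inl x)) =
          ((finLevel W N : Set (GA W)) * {(x : GA W)}).indicator fun _ => (1 : ℂ) := by
        simp only [u, Sum.elim_inl, Set.indicator_indicator, Set.inter_eq_right.2 hsub]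
      rw [this]
      exact RTF.hasFiniteRankLeftType_indicator_of_left_invariant (isCompact_coset (finLevel W N) hKc x)
        (isOpen_coset (finLevel W N) hKo x) (fun k hk g => coset_left_invariant (finLevel W N) hk x g) 1
    · have : X.indicator (u (Sum.inr ⟨w, i, j⟩)) =
          RTF.coeffFn (archMat W w) i j (X.indicator fun _ => (1 : ℂ)) := by
        funext g
        by_cases hg : g ∈ X
        · simp only [u, Sum.elim_inr, Set.indicator_of_mem hg, RTF.coeffFn, one_mul]
        · simp only [u, Sum.elim_inr, Set.indicator_of_notMem hg, RTF.coeffFn, zero_mul]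
      rw [this]
      exact RTF.hasFiniteRankLeftType_coeffFn (finLevel W N) (archMat W w) i j _ hX1t hX1inv
        (fun l j => continuous_archMat_entry W w l j)
  -- the fibre condition: same coset and same archimedean entries ⇒ same `K(N)`-class
  have hfib : ∀ x ∈ X, ∀ y ∈ X, (∀ i, u i x = u i y) → f₀ x = f₀ y := by
    intro x hx y _ huxy
    obtain ⟨s, hs, hxs⟩ := Set.mem_iUnion₂.1 (hcover hx)
    have h1 : u (Sum.inl ⟨s, hs⟩) x = 1 := by
      simp only [u, Sum.elim_inl, Set.indicator_of_mem hxs]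
    have hys : y ∈ (finLevel W N : Set (GA W)) * {s} := by
      by_contra hys
      have h2 : u (Sum.inl ⟨s, hs⟩) y = 0 := by
        simp only [u, Sum.elim_inl, Set.indicator_of_notMem hys]
      have := huxy (Sum.inl ⟨s, hs⟩)
      rw [h1, h2] at this
      exact one_ne_zero this
    have hyx : y * x⁻¹ ∈ finLevel W N := by
      have hx' := (mem_coset_iff (finLevel W N) s x).1 hxs
      have hy' := (mem_coset_iff (finLevel W N) s y).1 hys
      have : y * x⁻¹ = (y * s⁻¹) * (x * s⁻¹)⁻¹ := by group
      rw [this]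
      exact (finLevel W N).mul_mem hy' ((finLevel W N).inv_mem hx')
    have hk : y * x⁻¹ ∈ levelK W N :=
      mem_levelK_of_archMat_eq W hyx fun w i j => huxy (Sum.inr ⟨w, i, j⟩)
    have := hinv _ hk x
    rw [inv_mul_cancel_right] at this
    exact this.symm
  exact RTF.exists_finiteRankLeftType_approx hXc hXo hX1 u hu hut h₀ hf₀ hfib hη

/-- **the instance density for every test function, at a deep enough level**: with `hC : IsCompact (archImage W)`
and a compact open `X` left-invariant under `finLevel W N₁`, every test function `f₀` vanishing off `X` is uniformly
`η`-approximable by a test function vanishing off `X` of finite-rank left-`finLevel W N`-type for some level `N ≠ 0`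
(first the left average over a deep `K(N)` — `η/2`-close by uniform continuity — then the theorem above). -/
theorem exists_finiteRankLeftType_approx_deep [MeasurableSpace (GA W)] [BorelSpace (GA W)]
    (hC : IsCompact (archImage W)) {N₁ : ℕ} (hN₁ : N₁ ≠ 0)
    {X : Set (GA W)} (hXc : IsCompact X) (hXo : IsOpen X) (hKX : ∀ k ∈ finLevel W N₁, ∀ g, k * g ∈ X ↔ g ∈ X)
    {f₀ : GA W → ℂ} (h₀ : RTF.IsTest f₀) (hf₀ : ∀ g, g ∉ X → f₀ g = 0) {η : ℝ} (hη : 0 < η) :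
    ∃ N : ℕ, N ≠ 0 ∧ ∃ h : GA W → ℂ, RTF.IsTest h ∧ (∀ g, g ∉ X → h g = 0) ∧
      RTF.HasFiniteRankLeftType (finLevel W N) h ∧ ∀ g, ‖h g - f₀ g‖ ≤ η := by
  classical
  haveI : T2Space (GA W) := t2Space_GA W
  haveI : SecondCountableTopology (GA W) := secondCountable_GA W
  have hXcl : IsClosed X := hXc.isClosed
  -- uniform continuity on the left, and a level inside its neighbourhood
  obtain ⟨VL, hVLn, hVL⟩ := h₀.exists_nhds_norm_sub_lt_left (half_pos hη)
  obtain ⟨N₂, hN₂, hKV⟩ := exists_levelK_subset_nhds_one W hVLn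
  have hN : N₁ * N₂ ≠ 0 := mul_ne_zero hN₁ hN₂
  refine ⟨N₁ * N₂, hN, ?_⟩
  have hKc : IsCompact (levelK W (N₁ * N₂) : Set (GA W)) := isCompact_levelK W hN
  have hK2 : levelK W (N₁ * N₂) ≤ levelK W N₂ := levelK_antitone W (dvd_mul_left N₂ N₁)
  have hK1 : finLevel W (N₁ * N₂) ≤ finLevel W N₁ := by
    intro g hg
    rw [mem_finLevel] at hg ⊢
    exact ⟨fun i j => modSet_antitone k (dvd_mul_right N₁ N₂) (hg.1 i j),
      fun i j => modSet_antitone k (dvd_mul_right N₁ N₂) (hg.2 i j)⟩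
  have hKX' : ∀ k ∈ finLevel W (N₁ * N₂), ∀ g, k * g ∈ X ↔ g ∈ X := fun k hk g => hKX k (hK1 hk) g
  -- the left average over `K(N)`
  have hbound : ∃ C, ∀ x, ‖f₀ x‖ ≤ C := h₀.compact.exists_bound_of_continuous h₀.cont
  have hf₁c : Continuous (RTF.avgL (levelK W (N₁ * N₂)) hKc f₀) :=
    RTF.continuous_avgL (levelK W (N₁ * N₂)) hKc h₀.cont hbound
  have hf₁supp : tsupport (RTF.avgL (levelK W (N₁ * N₂)) hKc f₀) ⊆
      (levelK W (N₁ * N₂) : Set (GA W)) * tsupport f₀ :=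
    RTF.tsupport_avgL_subset (levelK W (N₁ * N₂)) hKc h₀.compact
  have hsuppX : tsupport f₀ ⊆ X :=
    closure_minimal (Function.support_subset_iff'.2 hf₀) hXcl
  have hf₁X : ∀ g, g ∉ X → RTF.avgL (levelK W (N₁ * N₂)) hKc f₀ g = 0 := by
    intro g hg
    apply image_eq_zero_of_notMem_tsupport
    intro hmem
    obtain ⟨a, ha, b, hb, rfl⟩ := Set.mem_mul.1 (hf₁supp hmem)
    exact hg ((hKX' a (levelK_le_finLevel W _ ha) b).2 (hsuppX hb))
  have hf₁inv : ∀ k ∈ levelK W (N₁ * N₂), ∀ g,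
      RTF.avgL (levelK W (N₁ * N₂)) hKc f₀ (k * g) = RTF.avgL (levelK W (N₁ * N₂)) hKc f₀ g :=
    fun k hk g => RTF.avgL_left_invariant (levelK W (N₁ * N₂)) hKc f₀ hk g
  have hf₁close : ∀ g, ‖RTF.avgL (levelK W (N₁ * N₂)) hKc f₀ g - f₀ g‖ ≤ η / 2 := by
    intro g
    refine RTF.norm_avgL_sub_le (levelK W (N₁ * N₂)) hKc h₀.cont (fun x k hk => ?_) g
    exact (hVL x k⁻¹ (hKV (hK2 ((levelK W (N₁ * N₂)).inv_mem hk)))).le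
  obtain ⟨h, hht, hhX, hhtype, hhclose⟩ := exists_finiteRankLeftType_approx_of_left_invariant W hC hN hXc hXo
    hKX' hf₁c hf₁X hf₁inv (half_pos hη)
  refine ⟨h, hht, hhX, hhtype, fun g => ?_⟩
  calc ‖h g - f₀ g‖
      = ‖(h g - RTF.avgL (levelK W (N₁ * N₂)) hKc f₀ g) + (RTF.avgL (levelK W (N₁ * N₂)) hKc f₀ g - f₀ g)‖ := by
        congr 1
        ring
    _ ≤ ‖h g - RTF.avgL (levelK W (N₁ * N₂)) hKc f₀ g‖ + ‖RTF.avgL (levelK W (N₁ * N₂)) hKc f₀ g - f₀ g‖ :=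
        norm_add_le _ _
    _ ≤ η / 2 + η / 2 := add_le_add (hhclose g) (hf₁close g)
    _ = η := by ring

end Density

end Summit.Ventures.HodgeRepro.Tier4.Line1

end
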